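import Mathlib.LinearAlgebra.Lagrange
import Literature.Combinatorics.Optimization.TracialDesigns
import Literature.Combinatorics.Optimization.SDPFormulationMatchingSlack
import HarnessLib

/-!
# Cell pnp-psdrank, route `ChebyshevTracialDesign`: the level-count obstruction (N3) — part 1, the fooling matrix

Planner p1's no-go N3 (HOME/pnp-psdrank-p1/ROUND-1.md §3, referee-CONFIRMED 2026-08-25T18:00Z; "new formulation,
in print up to assembly": the fooling matrix is the Hadamard square of a low-rank Hadamard square root,
Fawzi–Gouveia–Parrilo–Robinson–Thomas §5.2 / Lemma 5.4 / Cor. 5.5), kernel version.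

Let `W : OddSet n → PMatch n → ℝ` be a weight on (odd sets) × (perfect matchings) of `K_n` supported on the pairs
whose crossing number `cc U M = |δ(U) ∩ M|` lies in a set `C` of `ℓ` levels, `1 ∉ C` (the tight level excluded),
with `⟨W, S⟩ ≥ 0` for the odd-cut slack `S = pmOddCutSlack n = cc − 1`. Then there is a TIGHT-ORTHOGONAL PSD RECTANGLE
(`IsPsdRect`: `0 ⪯ X_U, Y_M ⪯ I`, `X_U Y_M = 0` whenever `cc U M = 1`) of dimension `r ≤ (ℓ+1)(n+1)^{2ℓ}` whose
normalised tracial value is at least `⟨W,S⟩ / ((ℓ+1)^5 (n+1)^{8ℓ+3})` (`levelCount_obstruction`). Consequently a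
tracial / hyperplane-separation certificate whose weight lives on `ℓ` crossing levels (Rothvoß's `W = μ_3 − μ_k/(k−1)`
has `ℓ = 2`) can only exclude psd factorizations of size `n^{O(ℓ)}`: the decay hypothesis `TracialValueLEAt W γ r`
FAILS at some `r ≤ (ℓ+1)(n+1)^{2ℓ}` as soon as `γ < ⟨W,S⟩/((ℓ+1)^5 (n+1)^{8ℓ+3})` (`not_tracialValueLEAt_of_levels`),
in particular for the multilevel design weights `levelWeight n t C w` of the route (`⟨W,S⟩ = Σ_c w_c (c−1)`,
`levelWeight_fooled`). This is why the route's designs charge `|C| = dq n + 1 ≍ n^{1/4}` levels, and it answers the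
literal form of the Gribling–de Laat–Laurent question (nc-lift of Rothvoß's two-level certificate) in the negative.

Mechanism: the polynomial `P` of degree `≤ ℓ` with `P(1) = 0`, `P(c) = √(c−1)` (`c ∈ C`) (Lagrange); `P(cc U M)` is an
inner product `⟨a_U, b_M⟩` in dimension `Σ_{j ≤ ℓ} |Sym2 (Fin n)|^j` because `cc U M = Σ_e [e crosses U]·[e ∈ M]`
(tensor-power trick, no rank theory); the fooling matrix `T = P(cc)²  = tr(a_U a_Uᵀ · b_M b_Mᵀ)` is a psd
factorization vanishing on the tight pairs with `⟨W,T⟩ = ⟨W,S⟩`; the tree's weak Briët–Dadush–Pokutta rescaling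
(`HasPsdFactorization.rescale_weak`) turns it into a psd rectangle.
WHAT THIS IS NOT: not a statement about psd rank of the matching polytope; it bounds what ONE certificate template
(weights on few crossing levels) can prove. Supports crux `TracialDecayExp20` (stmt-PneNP-19878) by delimiting it.
-/

set_option linter.dupNamespace false -- `Summit.PneNP.PneNP.…`: summit = sub-problem (D-0017)

noncomputable section

open scoped Classical MatrixOrder

namespace Summit.PneNP.PneNP.Theorems.ChebyshevTracialDesignLevelCount

open Finset Matrix Polynomial Literature.Barriers.PneNP Literature.Combinatorics.Optimization
  Literature.Combinatorics.SimpleGraph.CycleSpace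
  Literature.Computation.Certificates.SemidefiniteComplementarity

variable {n : ℕ}

/-! ### §1 The crossing number as an inner product, and its powers -/

/-- Indicator of the edge slots crossing `U`. -/
def chiU (U : OddSet n) : Sym2 (Fin n) → ℝ := fun e => if Crosses U.1 e then 1 else 0

/-- Indicator of the edges of `M`. -/
def chiM (M : PMatch n) : Sym2 (Fin n) → ℝ := fun e => if e ∈ M.1 then 1 else 0

/-- `cc U M = Σ_e [e crosses U]·[e ∈ M]`. -/
theorem cc_eq_sum (U : OddSet n) (M : PMatch n) : (cc U M : ℝ) = ∑ e, chiU U e * chiM M e := by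
  unfold cc chiU chiM
  rw [Finset.natCast_card_filter]
  calc (∑ e ∈ M.1, if Crosses U.1 e then (1 : ℝ) else 0)
      = ∑ e, if e ∈ M.1 then (if Crosses U.1 e then (1 : ℝ) else 0) else 0 := by
        rw [Finset.sum_ite_mem, univ_inter]
    _ = ∑ e, (if Crosses U.1 e then (1 : ℝ) else 0) * (if e ∈ M.1 then 1 else 0) := by
        refine sum_congr rfl fun e _ => ?_
        by_cases he : e ∈ M.1 <;> simp [he]

/-- Index set of the tensor-power linearisation: `Σ_{j ≤ ℓ} (Fin j → Sym2 (Fin n))`. -/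
abbrev Idx (n ℓ : ℕ) : Type := Σ j : Fin (ℓ + 1), (Fin j → Sym2 (Fin n))

/-- Row vector: `a_U ⟨j, f⟩ = p_j · Π_i [f i crosses U]`. -/
def aVec (ℓ : ℕ) (p : ℕ → ℝ) (U : OddSet n) : Idx n ℓ → ℝ :=
  fun x => p x.1 * ∏ i, chiU U (x.2 i)

/-- Column vector: `b_M ⟨j, f⟩ = Π_i [f i ∈ M]`. -/
def bVec (ℓ : ℕ) (M : PMatch n) : Idx n ℓ → ℝ :=
  fun x => ∏ i, chiM M (x.2 i)

/-- **Tensor-power trick**: `⟨a_U, b_M⟩ = Σ_{j ≤ ℓ} p_j · (cc U M)^j`. -/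
theorem aVec_dotProduct_bVec (ℓ : ℕ) (p : ℕ → ℝ) (U : OddSet n) (M : PMatch n) :
    aVec ℓ p U ⬝ᵥ bVec ℓ M = ∑ j ∈ range (ℓ + 1), p j * (cc U M : ℝ) ^ j := by
  unfold aVec bVec dotProduct
  rw [Fintype.sum_sigma, Finset.sum_range]
  refine sum_congr rfl fun j _ => ?_
  rw [cc_eq_sum, Finset.sum_pow', Fintype.piFinset_univ, mul_sum]
  refine sum_congr rfl fun f _ => ?_
  rw [prod_mul_distrib, mul_assoc]

/-! ### §2 The interpolating polynomial `P`: `P(1) = 0`, `P(c) = √(c − 1)` on `L`, `deg P ≤ |L|` -/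

/-- The nodes `{1} ∪ L`. -/
def nodes (L : Finset ℕ) : Finset ℕ := insert 1 L

/-- The Lagrange interpolant of `c ↦ √(c − 1)` at the nodes `{1} ∪ L`. -/
def interp (L : Finset ℕ) : ℝ[X] :=
  Lagrange.interpolate (nodes L) (fun c : ℕ => (c : ℝ)) (fun c : ℕ => Real.sqrt ((c : ℝ) - 1))

/-- The node map is injective. -/
theorem nodes_injOn (L : Finset ℕ) : Set.InjOn (fun c : ℕ => (c : ℝ)) (nodes L : Set ℕ) :=
  Nat.cast_injective.injOn

/-- `P(c) = √(c − 1)` at every node. -/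
theorem eval_interp_node {L : Finset ℕ} {c : ℕ} (hc : c ∈ nodes L) :
    (interp L).eval (c : ℝ) = Real.sqrt ((c : ℝ) - 1) := by
  unfold interp
  exact Lagrange.eval_interpolate_at_node _ (nodes_injOn L) hc

/-- `P(1) = 0`. -/
theorem eval_interp_one (L : Finset ℕ) : (interp L).eval 1 = 0 := by
  have h := eval_interp_node (L := L) (c := 1) (mem_insert_self 1 L)
  simp only [Nat.cast_one, sub_self, Real.sqrt_zero] at h
  exact h

/-- `P(c)² = c − 1` for `c ∈ L`. -/
theorem eval_interp_sq {L : Finset ℕ} {c : ℕ} (hc : c ∈ L) (hc1 : 1 ≤ c) :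
    ((interp L).eval (c : ℝ)) ^ 2 = (c : ℝ) - 1 := by
  rw [eval_interp_node (mem_insert_of_mem hc), Real.sq_sqrt]
  have : (1 : ℝ) ≤ c := by exact_mod_cast hc1
  linarith

/-- `deg P ≤ |L|` (when `1 ∉ L` the nodes are `|L| + 1` many). -/
theorem natDegree_interp_le {L : Finset ℕ} (h1 : 1 ∉ L) : (interp L).natDegree ≤ L.card := by
  have hdeg := Lagrange.degree_interpolate_lt (fun c : ℕ => Real.sqrt ((c : ℝ) - 1)) (nodes_injOn L)
  have hcard : (nodes L).card = L.card + 1 := by unfold nodes; rw [card_insert_of_notMem h1]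
  rw [hcard] at hdeg
  by_cases hP : interp L = 0
  · rw [hP, natDegree_zero]; exact Nat.zero_le _
  · have := (natDegree_lt_iff_degree_lt hP).2 hdeg
    omega

/-- `P(cc U M) = ⟨a_U, b_M⟩` with `p_j` = the coefficients of `P`. -/
theorem eval_interp_cc {L : Finset ℕ} (h1 : 1 ∉ L) (U : OddSet n) (M : PMatch n) :
    (interp L).eval (cc U M : ℝ) = aVec L.card (fun j => (interp L).coeff j) U ⬝ᵥ bVec L.card M := by
  rw [aVec_dotProduct_bVec,
    eval_eq_sum_range' (Nat.lt_succ_of_le (natDegree_interp_le h1))]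

/-! ### §3 A bound on `|P(z)|` for `0 ≤ z ≤ n` (Lagrange basis, integer nodes `≤ n + 1`) -/

/-- `|eval z (basisDivisor x y)| ≤ B` when `|x − y| ≥ 1` and `|z − y| ≤ B`. -/
theorem abs_eval_basisDivisor_le {x y z B : ℝ} (hxy : 1 ≤ |x - y|) (hzy : |z - y| ≤ B) :
    |(Lagrange.basisDivisor x y).eval z| ≤ B := by
  unfold Lagrange.basisDivisor
  rw [eval_mul, eval_C, eval_sub, eval_X, eval_C, abs_mul, abs_inv]
  have h0 : 0 < |x - y| := lt_of_lt_of_le one_pos hxy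
  calc |x - y|⁻¹ * |z - y| ≤ 1 * |z - y| := by
        apply mul_le_mul_of_nonneg_right _ (abs_nonneg _)
        rw [inv_le_comm₀ h0 one_pos, inv_one]; exact hxy
    _ ≤ B := by rw [one_mul]; exact hzy

/-- `|eval z (basis s v i)| ≤ B ^ (s.card − 1)` for integer-like nodes (pairwise distance `≥ 1`) within `B` of `z`,
`B ≥ 1`... stated with `B ^ s.card` for convenience (`B ≥ 1`). -/
theorem abs_eval_basis_le {ι : Type*} [DecidableEq ι] (s : Finset ι) (v : ι → ℝ) (i : ι) {z B : ℝ} (hB : 1 ≤ B)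
    (hsep : ∀ j ∈ s, j ≠ i → 1 ≤ |v i - v j|) (hz : ∀ j ∈ s, |z - v j| ≤ B) :
    |(Lagrange.basis s v i).eval z| ≤ B ^ s.card := by
  unfold Lagrange.basis
  rw [eval_prod, abs_prod]
  calc ∏ j ∈ s.erase i, |(Lagrange.basisDivisor (v i) (v j)).eval z| ≤ ∏ j ∈ s.erase i, B := by
        refine prod_le_prod (fun j _ => abs_nonneg _) fun j hj => ?_
        exact abs_eval_basisDivisor_le (hsep j (mem_of_mem_erase hj) (ne_of_mem_erase hj))
          (hz j (mem_of_mem_erase hj))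
    _ = B ^ (s.erase i).card := prod_const B
    _ ≤ B ^ s.card := pow_le_pow_right₀ hB (card_erase_le)

/-- **`|P(z)| ≤ (|L| + 1) · √n · (n + 1)^{|L|+1}`** for `0 ≤ z ≤ n`, when all levels in `L` are `≤ n`. -/
theorem abs_eval_interp_le {L : Finset ℕ} (h1 : 1 ∉ L) (hLn : ∀ c ∈ L, c ≤ n) {z : ℝ} (hz0 : 0 ≤ z)
    (hzn : z ≤ n) :
    |(interp L).eval z| ≤ (L.card + 1) * Real.sqrt n * ((n : ℝ) + 1) ^ (L.card + 1) := by
  have hcard : (nodes L).card = L.card + 1 := by unfold nodes; rw [card_insert_of_notMem h1]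
  have hnode : ∀ j ∈ nodes L, (0 : ℝ) ≤ j ∧ (j : ℝ) ≤ (n : ℝ) + 1 := by
    intro j hj
    refine ⟨Nat.cast_nonneg j, ?_⟩
    rcases mem_insert.1 hj with rfl | hj
    · simp
    · have : (j : ℝ) ≤ n := by exact_mod_cast hLn j hj
      linarith
  unfold interp
  rw [Lagrange.interpolate_apply, eval_finsetSum]
  calc |∑ j ∈ nodes L, ((C (Real.sqrt ((j : ℝ) - 1)) * Lagrange.basis (nodes L) (fun c : ℕ => (c : ℝ)) j).eval z)|
      ≤ ∑ j ∈ nodes L, |(C (Real.sqrt ((j : ℝ) - 1)) * Lagrange.basis (nodes L) (fun c : ℕ => (c : ℝ)) j).eval z| :=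
        abs_sum_le_sum_abs _ _
    _ ≤ ∑ j ∈ nodes L, Real.sqrt n * ((n : ℝ) + 1) ^ (L.card + 1) := by
        refine sum_le_sum fun j hj => ?_
        rw [eval_mul, eval_C, abs_mul]
        refine mul_le_mul ?_ ?_ (abs_nonneg _) (Real.sqrt_nonneg _)
        · rw [abs_of_nonneg (Real.sqrt_nonneg _)]
          apply Real.sqrt_le_sqrt
          linarith [(hnode j hj).2]
        · rw [← hcard]
          refine abs_eval_basis_le (nodes L) (fun c : ℕ => (c : ℝ)) j (by linarith) ?_ ?_
          · intro k hk hkj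
            have hne : (k : ℝ) ≠ (j : ℝ) := fun h => (hkj (Nat.cast_injective h)).elim
            rcases lt_or_gt_of_ne hne with hlt | hlt
            · have : (k : ℝ) + 1 ≤ j := by exact_mod_cast (show k + 1 ≤ j by exact_mod_cast hlt)
              rw [abs_of_pos (by linarith)]; linarith
            · have : (j : ℝ) + 1 ≤ k := by exact_mod_cast (show j + 1 ≤ k by exact_mod_cast hlt)
              rw [abs_of_neg (by linarith)]; linarith
          · intro k hk
            have := hnode k hk
            rw [abs_le]; constructor <;> linarith
    _ = (L.card + 1) * Real.sqrt n * ((n : ℝ) + 1) ^ (L.card + 1) := by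
        rw [sum_const, hcard, nsmul_eq_mul]; push_cast; ring

/-! ### §4 Crossing numbers: `1 ≤ cc U M ≤ n` -/

/-- `1 ≤ cc U M` (odd cuts are crossed). -/
theorem one_le_cc (U : OddSet n) (M : PMatch n) : 1 ≤ cc U M := by
  rw [cc_eq_card_filter]
  exact M.2.one_le_card_cut (subset_univ _) U.2

/-- `cc U M ≤ n`. -/
theorem cc_le (U : OddSet n) (M : PMatch n) : cc U M ≤ n := by
  rw [cc_eq_card_filter]
  refine (M.2.card_cut_le (subset_univ _)).trans ?_
  exact (card_le_univ _).trans (by rw [Fintype.card_fin])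

/-! ### §5 The fooling matrix `T = P(cc)²` and its psd factorization of dimension `Σ_{j ≤ ℓ} |Sym2 (Fin n)|^j` -/

/-- The dimension `ρ(n, ℓ) = Σ_{j ≤ ℓ} |Sym2 (Fin n)|^j` of the fooling factorization. -/
def dimN (n ℓ : ℕ) : ℕ := Fintype.card (Idx n ℓ)

/-- `ρ ≥ 1`. -/
theorem dimN_pos (n ℓ : ℕ) : 0 < dimN n ℓ :=
  Fintype.card_pos_iff.2 ⟨⟨0, Fin.elim0⟩⟩

/-- `ρ ≤ (ℓ + 1) (n + 1)^{2ℓ}`. -/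
theorem dimN_le (n ℓ : ℕ) : (dimN n ℓ : ℝ) ≤ (ℓ + 1) * ((n : ℝ) + 1) ^ (2 * ℓ) := by
  have hn : (0 : ℝ) ≤ n := Nat.cast_nonneg n
  have hE : (Fintype.card (Sym2 (Fin n)) : ℝ) ≤ ((n : ℝ) + 1) ^ 2 := by
    have h1 : (Fintype.card (Sym2 (Fin n)) : ℝ) ≤ (n : ℝ) ^ 2 := by exact_mod_cast card_sym2_fin_le n
    nlinarith
  have h1sq : (1 : ℝ) ≤ ((n : ℝ) + 1) ^ 2 := by nlinarith
  unfold dimN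
  rw [Fintype.card_sigma]
  push_cast
  calc ∑ j : Fin (ℓ + 1), (Fintype.card (Fin j → Sym2 (Fin n)) : ℝ)
      ≤ ∑ _j : Fin (ℓ + 1), ((n : ℝ) + 1) ^ (2 * ℓ) := by
        refine sum_le_sum fun j _ => ?_
        rw [Fintype.card_fun, Fintype.card_fin]
        push_cast
        calc (Fintype.card (Sym2 (Fin n)) : ℝ) ^ (j : ℕ) ≤ (((n : ℝ) + 1) ^ 2) ^ (j : ℕ) :=
              pow_le_pow_left₀ (Nat.cast_nonneg _) hE _
          _ ≤ (((n : ℝ) + 1) ^ 2) ^ ℓ :=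
              pow_le_pow_right₀ h1sq (Nat.lt_succ_iff.1 j.2)
          _ = ((n : ℝ) + 1) ^ (2 * ℓ) := by rw [← pow_mul]
    _ = (ℓ + 1) * ((n : ℝ) + 1) ^ (2 * ℓ) := by
        rw [sum_const, card_univ, Fintype.card_fin, nsmul_eq_mul]; push_cast; ring

/-- The fooling matrix `T(U, M) = P(cc U M)²` for the level set `L`. -/
def fool (L : Finset ℕ) (U : OddSet n) (M : PMatch n) : ℝ := ((interp L).eval (cc U M : ℝ)) ^ 2

/-- **`T` has a psd factorization of size `ρ(n, |L|)`** (rank-one factors `a_U a_Uᵀ`, `b_M b_Mᵀ`). -/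
theorem fool_hasPsdFactorization {L : Finset ℕ} (h1 : 1 ∉ L) :
    HasPsdFactorization (fool (n := n) L) (dimN n L.card) := by
  set e := Fintype.equivFin (Idx n L.card) with he
  set a : OddSet n → Fin (dimN n L.card) → ℝ :=
    fun U k => aVec L.card (fun j => (interp L).coeff j) U (e.symm k) with ha
  set b : PMatch n → Fin (dimN n L.card) → ℝ := fun M k => bVec L.card M (e.symm k) with hb
  have hab : ∀ U M, a U ⬝ᵥ b M = (interp L).eval (cc U M : ℝ) := by
    intro U M
    rw [eval_interp_cc h1, ha, hb]
    unfold dotProduct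
    exact Equiv.sum_comp e.symm (fun x => aVec L.card (fun j => (interp L).coeff j) U x * bVec L.card M x)
  refine ⟨fun U => vecMulVec (a U) (a U), fun M => vecMulVec (b M) (b M),
    fun U => by simpa using posSemidef_vecMulVec_self_star (a U),
    fun M => by simpa using posSemidef_vecMulVec_self_star (b M), fun U M => ?_⟩
  rw [vecMulVec_mul_vecMulVec, trace_vecMulVec, dotProduct_smul, smul_eq_mul, hab, fool, sq]

/-- `T = 0` on the tight pairs. -/
theorem fool_eq_zero_of_cc_eq_one (L : Finset ℕ) {U : OddSet n} {M : PMatch n} (h : cc U M = 1) :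
    fool L U M = 0 := by
  unfold fool
  rw [h, Nat.cast_one, eval_interp_one]; ring

/-- `T = S` on the levels of `L`. -/
theorem fool_eq_slack_of_mem {L : Finset ℕ} {U : OddSet n} {M : PMatch n} (h : cc U M ∈ L) :
    fool L U M = pmOddCutSlack n U M := by
  unfold fool
  rw [eval_interp_sq h (one_le_cc U M), pmOddCutSlack_apply]

/-- The entry bound `Δ_T = (|L| + 1)² (n + 1)^{2|L| + 3}`. -/
def foolBound (n ℓ : ℕ) : ℝ := ((ℓ : ℝ) + 1) ^ 2 * ((n : ℝ) + 1) ^ (2 * ℓ + 3)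

/-- `Δ_T > 0`. -/
theorem foolBound_pos (n ℓ : ℕ) : 0 < foolBound n ℓ := by unfold foolBound; positivity

/-- `0 ≤ T ≤ Δ_T`. -/
theorem fool_le {L : Finset ℕ} (h1 : 1 ∉ L) (hLn : ∀ c ∈ L, c ≤ n) (U : OddSet n) (M : PMatch n) :
    fool L U M ≤ foolBound n L.card := by
  have hb := abs_eval_interp_le h1 hLn (z := (cc U M : ℝ)) (Nat.cast_nonneg _)
    (by exact_mod_cast cc_le U M)
  have h0 : 0 ≤ ((L.card : ℝ) + 1) * Real.sqrt n * ((n : ℝ) + 1) ^ (L.card + 1) := by positivity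
  unfold fool foolBound
  rw [← sq_abs]
  calc |(interp L).eval (cc U M : ℝ)| ^ 2
      ≤ (((L.card : ℝ) + 1) * Real.sqrt n * ((n : ℝ) + 1) ^ (L.card + 1)) ^ 2 :=
        pow_le_pow_left₀ (abs_nonneg _) hb 2
    _ = ((L.card : ℝ) + 1) ^ 2 * (Real.sqrt n) ^ 2 * ((n : ℝ) + 1) ^ (2 * L.card + 2) := by ring
    _ ≤ ((L.card : ℝ) + 1) ^ 2 * ((n : ℝ) + 1) * ((n : ℝ) + 1) ^ (2 * L.card + 2) := by
        rw [Real.sq_sqrt (Nat.cast_nonneg n)]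
        have : (n : ℝ) ≤ (n : ℝ) + 1 := by linarith
        gcongr
    _ = ((L.card : ℝ) + 1) ^ 2 * ((n : ℝ) + 1) ^ (2 * L.card + 3) := by ring

end Summit.PneNP.PneNP.Theorems.ChebyshevTracialDesignLevelCount

end
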